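/-
Copyright (c) 2026. All rights reserved.
Released under Apache 2.0 license as described in the file LICENSE.
Authors: abc-iut cell, WAVE-5 prover seat abc-iut-w5-d180 (gen 10).
-/
import Literature.NumberTheory.NumberFields.DedekindDifferentBoundGeneral
import Literature.IUT.LogVolume.DifferentOrdDivisor
import Literature.IUT.LogVolume.DepthConstantsTameBudget
import HarnessLib

/-!
# Hensel's different bound at a GENUINE completion: `d(K_w) ≤ 1 − 1/e + v_p(e)`, and the WILD budget
# `d + a + b ≤ 1 + 1/(p−2) + k − (p−1)/((p−2)e) + v_p(e)` for the [IUTchIV] Prop. 1.2 constants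

PROOF-ONLY companion (classical local/global number theory; nothing disputed; no definition, no `Prop` fact,
no instance) of `DifferentOrdDivisor.lean` (`differentOrd_rescaledCompletion`: `d(K_w) = ord_w(𝔇_{K/ℤ})/e(w|p)`,
Serre, *Corps locaux* III §4 Prop. 10), `DepthConstantsBound.lean` (`differentOrd_lt_one_add_padicValNat_finrank`:
Lenstra's bound `d(K) < 1 + v_p([K:ℚ_p])` at `k₀ = ℚ_p`) and `DepthConstantsTameBudget.lean` (the TAME budget
`depthConstants_le_of_not_dvd`, `p ∤ e`). The tree's `DedekindDifferentBoundGeneral.lean`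
(`Literature.NumberTheory.NumberFields.multiplicity_differentIdeal_lt_absolute`) already PROVES the Dedekind–Hensel
bound `ord_P 𝔇_{M/L} ≤ e − 1 + ord_P(e)` for EVERY extension of number fields (no Galois hypothesis; Serre,
*Corps locaux* III §6, Remarque after Prop. 13; Neukirch ANT III (2.6)). HERE it is read through the local–global
bridge, for the completion `K_w` of a number field `K` at a finite place `w ∣ p` in the campaign-S presentation
`RescaledCompletion K p w hw` (= the factor fields `kOf X p x₀` of the cell's pilot packets, by `rfl`):

* §1 `absNorm_under_int_eq_of_natCast_mem` — `N(w ∩ ℤ) = p`; **`multiplicity_differentIdeal_int_succ_le`** —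
  `ord_w(𝔇_{K/ℤ}) + 1 ≤ e(w|p)·(v_p(e(w|p)) + 1)`, i.e. `ord_w(𝔇_{K/ℤ}) ≤ e − 1 + e·v_p(e)`;
  `succ_le_of_pow_dvd_differentIdeal_int` — `w^n ∣ 𝔇_{K/ℤ} ⇒ n + 1 ≤ e·(v_p(e) + 1)`.
* §2 **`differentOrd_rescaledCompletion_le`** — `d(K_w) ≤ 1 − 1/e + v_p(e)` (`e = e(K_w/ℚ_p)`, the SHARP form of
  Lenstra's bound: `v_p(e)` in place of `v_p([K_w:ℚ_p]) = v_p(e·f)`), `differentOrd_rescaledCompletion_lt` —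
  `d(K_w) < 1 + v_p(e)`, and `differentOrd_rescaledCompletion_le_two_sub_inv` — `v_p(e) ≤ 1 ⇒ d ≤ 2 − 1/e`
  (`ord_w 𝔇 ≤ 2e − 1`, the exact value at the cell's «W1-type» wild packets together with the landed lower bound).
* §3 **`depthConstants_rescaledCompletion_le_of_lt_window`** — `p > 2`, `p·e < p^{k+1}·(p−1)`, ANY `e` (wild
  allowed): `d + a + b ≤ 1 + 1/(p−2) + k − (p−1)/((p−2)·e) + v_p(e)` — the `p ∣ e` companion of
  `depthConstants_le_of_not_dvd` (same right-hand side plus the wild term `v_p(e)`);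
  `depthConstants_rescaledCompletion_lt_of_lt_window` — `< 1 + 1/(p−2) + k + v_p(e)`;
  `depthConstants_rescaledCompletion_le_of_lt_pow` — `e < p^B·(p−1) ⇒ d + a + b ≤ B + 1 + 1/(p−2) − 1/e + v_p(e)`
  (the shape of the cell's [LIN] socket bound, now uniform in the local type INCLUDING wild places).

What is NOT here: the same bound for an ABSTRACT `p`-adic field of the norm-side setting (that needs the maximal
unramified subextension as a normed subalgebra; the genuine completions are what the cell's certificates consume),
any log-shell / log-volume statement, anything about [IUTchIII] Cor. 3.12.
[cite: SerreLocalFields1979, Ch. III §4 Prop. 10; §6 Prop. 13 and Remark] [cite: NeukirchANT1999, Ch. III (2.6)]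
[cite: Mochizuki2012, IUTchIV Prop. 1.2 p. 10, Prop. 1.3 p. 12]
-/

noncomputable section

namespace Literature.IUT.LogVolume

open NumberField IsDedekindDomain Literature.NumberTheory.NumberFields

variable (K : Type) [Field K] [NumberField K] (p : ℕ) [Fact p.Prime]
  (w : HeightOneSpectrum (𝓞 K)) (hw : ((p : ℕ) : 𝓞 K) ∈ w.asIdeal)

/-! ## §1. The global exponent: `ord_w(𝔇_{K/ℤ}) ≤ e − 1 + e·v_p(e)` -/

omit [NumberField K] in
include hw in
/-- **`N(w ∩ ℤ) = p`** for a finite place `w ∣ p` of a number field: the positive generator of `w ∩ ℤ` is a prime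
dividing `p`. [cite: NeukirchANT1999, Ch. I (8.2)] -/
theorem absNorm_under_int_eq_of_natCast_mem : Ideal.absNorm (w.asIdeal.under ℤ) = p := by
  haveI : NeZero w.asIdeal := ⟨w.ne_bot⟩
  have hdvd : Ideal.absNorm (w.asIdeal.under ℤ) ∣ p :=
    (natCast_mem_iff_absNorm_under_dvd K w.asIdeal p).mp hw
  exact (Nat.prime_dvd_prime_iff_eq (Nat.absNorm_under_prime w.asIdeal) (Fact.out : p.Prime)).mp hdvd

include hw in
/-- **Dedekind–Hensel at a finite place `w ∣ p` of a number field `K`, absolute form: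
`ord_w(𝔇_{K/ℤ}) + 1 ≤ e(w|p)·(v_p(e(w|p)) + 1)`**, i.e. `ord_w(𝔇_{K/ℤ}) ≤ e − 1 + e·v_p(e)` — the tree's
`multiplicity_differentIdeal_lt_absolute` (every extension `M/L`; here `L = ℚ`, base presented as `ℤ` via
`differentIdeal_int_eq_differentIdeal_ringOfIntegers_rat`, `e(w | w ∩ 𝓞ℚ) ∣ e(w|p)`).
[cite: SerreLocalFields1979, Ch. III §6 Prop. 13 and Remark] [cite: NeukirchANT1999, Ch. III (2.6)] -/
theorem multiplicity_differentIdeal_int_succ_le :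
    multiplicity w.asIdeal (differentIdeal ℤ (𝓞 K)) + 1 ≤
      w.asIdeal.ramificationIdx ℤ * (padicValNat p (w.asIdeal.ramificationIdx ℤ) + 1) := by
  have h := multiplicity_differentIdeal_lt_absolute ℚ K w.asIdeal
  rw [← differentIdeal_int_eq_differentIdeal_ringOfIntegers_rat K,
    absNorm_under_int_eq_of_natCast_mem K p w hw] at h
  have he0 : w.asIdeal.ramificationIdx ℤ ≠ 0 := (Ideal.ramificationIdx_pos w.asIdeal ℤ).ne'
  have hdvd : w.asIdeal.ramificationIdx (𝓞 ℚ) ∣ w.asIdeal.ramificationIdx ℤ :=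
    ramificationIdx_rel_dvd_ramificationIdx_int ℚ K w.asIdeal
  have hrel0 : w.asIdeal.ramificationIdx (𝓞 ℚ) ≠ 0 := ne_zero_of_dvd_ne_zero he0 hdvd
  have hfac : (w.asIdeal.ramificationIdx (𝓞 ℚ)).factorization p ≤
      padicValNat p (w.asIdeal.ramificationIdx ℤ) := by
    rw [← Nat.factorization_def (w.asIdeal.ramificationIdx ℤ) (Fact.out : p.Prime)]
    exact (Nat.factorization_le_iff_dvd hrel0 he0).mpr hdvd p
  calc multiplicity w.asIdeal (differentIdeal ℤ (𝓞 K)) + 1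
      ≤ w.asIdeal.ramificationIdx ℤ * ((w.asIdeal.ramificationIdx (𝓞 ℚ)).factorization p + 1) := h
    _ ≤ w.asIdeal.ramificationIdx ℤ * (padicValNat p (w.asIdeal.ramificationIdx ℤ) + 1) :=
        Nat.mul_le_mul_left _ (Nat.add_le_add_right hfac 1)

include hw in
/-- **`w^n ∣ 𝔇_{K/ℤ} ⇒ n + 1 ≤ e(w|p)·(v_p(e(w|p)) + 1)`** (divisibility form of Dedekind–Hensel at `w ∣ p`).
[cite: SerreLocalFields1979, Ch. III §6 Prop. 13 and Remark] -/
theorem succ_le_of_pow_dvd_differentIdeal_int {n : ℕ} (hn : w.asIdeal ^ n ∣ differentIdeal ℤ (𝓞 K)) :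
    n + 1 ≤ w.asIdeal.ramificationIdx ℤ * (padicValNat p (w.asIdeal.ramificationIdx ℤ) + 1) := by
  have hfin : FiniteMultiplicity w.asIdeal (differentIdeal ℤ (𝓞 K)) :=
    FiniteMultiplicity.of_prime_left w.prime (differentIdeal_ne_bot' K)
  have hle : n ≤ multiplicity w.asIdeal (differentIdeal ℤ (𝓞 K)) := hfin.le_multiplicity_of_pow_dvd hn
  have h := multiplicity_differentIdeal_int_succ_le K p w hw
  omega

/-! ## §2. The local form at the genuine completion `K_w` -/

/-- **Hensel's bound for the completion: `d(K_w) ≤ 1 − 1/e + v_p(e)`**, `e = e(K_w/ℚ_p) = e(w|p)`, for the completion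
`K_w = RescaledCompletion K p w hw` of a number field `K` at a finite place `w ∣ p` — the sharp form of Lenstra's
bound ([IUTchIV] Prop. 1.3 at the maximal unramified subfield: `v_p(e)` instead of `v_p([K_w:ℚ_p])`), obtained from the
GLOBAL Dedekind–Hensel bound (`multiplicity_differentIdeal_int_succ_le`) through `d(K_w) = ord_w(𝔇_{K/ℤ})/e(w|p)`
(`differentOrd_rescaledCompletion`, Serre III §4 Prop. 10).
[cite: SerreLocalFields1979, Ch. III §4 Prop. 10; §6 Prop. 13 and Remark] [cite: Mochizuki2012, IUTchIV Prop. 1.3 p. 12] -/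
theorem differentOrd_rescaledCompletion_le :
    differentOrd p (RescaledCompletion K p w hw) ≤
      1 - 1 / (absRamificationIdx p (RescaledCompletion K p w hw) : ℝ)
        + padicValNat p (absRamificationIdx p (RescaledCompletion K p w hw)) := by
  rw [differentOrd_rescaledCompletion K p w hw, absRamificationIdx_rescaledCompletion K p w hw]
  have he : 0 < w.asIdeal.ramificationIdx ℤ := Ideal.ramificationIdx_pos w.asIdeal ℤ
  have he' : (0 : ℝ) < (w.asIdeal.ramificationIdx ℤ : ℝ) := by exact_mod_cast he
  have h := multiplicity_differentIdeal_int_succ_le K p w hw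
  have h' : ((multiplicity w.asIdeal (differentIdeal ℤ (𝓞 K)) : ℕ) : ℝ) + 1 ≤
      (w.asIdeal.ramificationIdx ℤ : ℝ) * ((padicValNat p (w.asIdeal.ramificationIdx ℤ) : ℝ) + 1) := by
    exact_mod_cast h
  rw [div_le_iff₀ he']
  have hid : (1 - 1 / (w.asIdeal.ramificationIdx ℤ : ℝ) + (padicValNat p (w.asIdeal.ramificationIdx ℤ) : ℝ)) *
      (w.asIdeal.ramificationIdx ℤ : ℝ) =
      (w.asIdeal.ramificationIdx ℤ : ℝ) * ((padicValNat p (w.asIdeal.ramificationIdx ℤ) : ℝ) + 1) - 1 := by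
    field_simp
    ring
  rw [hid]
  linarith

/-- **`d(K_w) < 1 + v_p(e)`** (`e = e(K_w/ℚ_p)`): the strict form of Hensel's bound at a genuine completion, sharpening
the tree's `differentOrd_lt_one_add_padicValNat_finrank` (`d < 1 + v_p([K_w:ℚ_p])`).
[cite: SerreLocalFields1979, Ch. III §6 Prop. 13 and Remark] -/
theorem differentOrd_rescaledCompletion_lt :
    differentOrd p (RescaledCompletion K p w hw) <
      1 + padicValNat p (absRamificationIdx p (RescaledCompletion K p w hw)) := by
  have h := differentOrd_rescaledCompletion_le K p w hw
  have he' : (0 : ℝ) < (absRamificationIdx p (RescaledCompletion K p w hw) : ℝ) := by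
    exact_mod_cast absRamificationIdx_pos p (RescaledCompletion K p w hw)
  have hinv : 0 < 1 / (absRamificationIdx p (RescaledCompletion K p w hw) : ℝ) := by positivity
  linarith

/-- **`v_p(e) ≤ 1 ⇒ d(K_w) ≤ 2 − 1/e`** (i.e. `ord_w 𝔇_{K/ℤ} ≤ 2e − 1`): Hensel's bound at a place whose ramification index
is divisible by `p` at most once — e.g. `e = 30·l` over `p = 3`, `l ≠ 3` prime, where together with the landed lower
bound `2e − 1 ≤ ord_w 𝔇` it pins the wild different exactly. [cite: SerreLocalFields1979, Ch. III §6 Prop. 13 and Remark] -/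
theorem differentOrd_rescaledCompletion_le_two_sub_inv
    (hv : padicValNat p (absRamificationIdx p (RescaledCompletion K p w hw)) ≤ 1) :
    differentOrd p (RescaledCompletion K p w hw) ≤
      2 - 1 / (absRamificationIdx p (RescaledCompletion K p w hw) : ℝ) := by
  have h := differentOrd_rescaledCompletion_le K p w hw
  have hv' : (padicValNat p (absRamificationIdx p (RescaledCompletion K p w hw)) : ℝ) ≤ 1 := by
    exact_mod_cast hv
  linarith

include hw in
/-- **`v_p(e(w|p)) ≤ 1 ⇒ ord_w(𝔇_{K/ℤ}) + 1 ≤ 2·e(w|p)`** (integer form of the previous bound: `ord_w 𝔇 ≤ 2e − 1`).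
[cite: SerreLocalFields1979, Ch. III §6 Prop. 13 and Remark] -/
theorem multiplicity_differentIdeal_int_succ_le_two_mul
    (hv : padicValNat p (w.asIdeal.ramificationIdx ℤ) ≤ 1) :
    multiplicity w.asIdeal (differentIdeal ℤ (𝓞 K)) + 1 ≤ 2 * w.asIdeal.ramificationIdx ℤ := by
  have h := multiplicity_differentIdeal_int_succ_le K p w hw
  have h2 : w.asIdeal.ramificationIdx ℤ * (padicValNat p (w.asIdeal.ramificationIdx ℤ) + 1) ≤
      w.asIdeal.ramificationIdx ℤ * 2 := Nat.mul_le_mul_left _ (by omega)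
  calc multiplicity w.asIdeal (differentIdeal ℤ (𝓞 K)) + 1
      ≤ w.asIdeal.ramificationIdx ℤ * (padicValNat p (w.asIdeal.ramificationIdx ℤ) + 1) := h
    _ ≤ w.asIdeal.ramificationIdx ℤ * 2 := h2
    _ = 2 * w.asIdeal.ramificationIdx ℤ := Nat.mul_comm _ _

/-! ## §3. The [IUTchIV] Prop. 1.2 budget `d + a + b` at a genuine completion, wild places allowed -/

/-- **WILD budget: `d + a + b ≤ 1 + 1/(p−2) + k − (p−1)/((p−2)·e) + v_p(e)`** at the genuine completion `K_w`, for
`p > 2` and ANY ramification index `e = e(K_w/ℚ_p)` with `p·e < p^{k+1}·(p−1)` (`d ≤ 1 − 1/e + v_p(e)` Hensel,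
`a ≤ 1/(p−2) + (p−3)/((p−2)e)`, `b ≤ k − 1/e`) — the companion of the tame `depthConstants_le_of_not_dvd`
(identical right-hand side, plus the wild term `v_p(e)`, which vanishes when `p ∤ e`).
[cite: Mochizuki2012, IUTchIV Prop. 1.2 p. 10] [cite: SerreLocalFields1979, Ch. III §6 Prop. 13 and Remark] -/
theorem depthConstants_rescaledCompletion_le_of_lt_window {k : ℕ} (hp : 2 < p)
    (hhi : p * absRamificationIdx p (RescaledCompletion K p w hw) < p ^ (k + 1) * (p - 1)) :
    differentOrd p (RescaledCompletion K p w hw)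
      + logRadiusA p (absRamificationIdx p (RescaledCompletion K p w hw))
      + logRadiusB p (absRamificationIdx p (RescaledCompletion K p w hw)) ≤
      1 + 1 / ((p : ℝ) - 2) + k
        - ((p : ℝ) - 1) / (((p : ℝ) - 2) * absRamificationIdx p (RescaledCompletion K p w hw))
        + padicValNat p (absRamificationIdx p (RescaledCompletion K p w hw)) := by
  have he := absRamificationIdx_pos p (RescaledCompletion K p w hw)
  have he' : (0 : ℝ) < (absRamificationIdx p (RescaledCompletion K p w hw) : ℝ) := by exact_mod_cast he
  have hp2 : (0 : ℝ) < (p : ℝ) - 2 := by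
    have : (2 : ℝ) < p := by exact_mod_cast hp
    linarith
  have hd := differentOrd_rescaledCompletion_le K p w hw
  have ha := logRadiusA_le_of_two_lt (p := p) (e := absRamificationIdx p (RescaledCompletion K p w hw)) hp he
  have hb := logRadiusB_le_of_lt_window (p := p) (e := absRamificationIdx p (RescaledCompletion K p w hw))
    (k := k) (by omega) he hhi
  have hident : (1 - 1 / (absRamificationIdx p (RescaledCompletion K p w hw) : ℝ))
      + (1 / ((p : ℝ) - 2) + ((p : ℝ) - 3) / (((p : ℝ) - 2) * absRamificationIdx p (RescaledCompletion K p w hw)))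
      + ((k : ℝ) - 1 / absRamificationIdx p (RescaledCompletion K p w hw))
      = 1 + 1 / ((p : ℝ) - 2) + k
        - ((p : ℝ) - 1) / (((p : ℝ) - 2) * absRamificationIdx p (RescaledCompletion K p w hw)) := by
    field_simp
    ring
  linarith

/-- **WILD budget, strict: `d + a + b < 1 + 1/(p−2) + k + v_p(e)`** (`p > 2`, `p·e < p^{k+1}·(p−1)`, any `e`).
[cite: Mochizuki2012, IUTchIV Prop. 1.2 p. 10] [cite: SerreLocalFields1979, Ch. III §6 Prop. 13 and Remark] -/
theorem depthConstants_rescaledCompletion_lt_of_lt_window {k : ℕ} (hp : 2 < p)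
    (hhi : p * absRamificationIdx p (RescaledCompletion K p w hw) < p ^ (k + 1) * (p - 1)) :
    differentOrd p (RescaledCompletion K p w hw)
      + logRadiusA p (absRamificationIdx p (RescaledCompletion K p w hw))
      + logRadiusB p (absRamificationIdx p (RescaledCompletion K p w hw)) <
      1 + 1 / ((p : ℝ) - 2) + k + padicValNat p (absRamificationIdx p (RescaledCompletion K p w hw)) := by
  have h1 := depthConstants_rescaledCompletion_le_of_lt_window K p w hw hp hhi
  have he' : (0 : ℝ) < (absRamificationIdx p (RescaledCompletion K p w hw) : ℝ) := by
    exact_mod_cast absRamificationIdx_pos p (RescaledCompletion K p w hw)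
  have hp2 : (0 : ℝ) < (p : ℝ) - 2 := by
    have : (2 : ℝ) < p := by exact_mod_cast hp
    linarith
  have hpos : 0 < ((p : ℝ) - 1) / (((p : ℝ) - 2) * absRamificationIdx p (RescaledCompletion K p w hw)) :=
    div_pos (by linarith) (mul_pos hp2 he')
  linarith

/-- **WILD budget in the [LIN] shape: `e < p^B·(p−1) ⇒ d + a + b ≤ B + 1 + 1/(p−2) − 1/e + v_p(e)`** (`p > 2`, any `e`)
— the right-hand side of the cell's tame socket bound `depthConstants_le_of_not_dvd_of_lt_pow` plus the wild term
`v_p(e)`, valid at EVERY place of a genuine completion. [cite: Mochizuki2012, IUTchIV Prop. 1.2 p. 10]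
[cite: SerreLocalFields1979, Ch. III §6 Prop. 13 and Remark] -/
theorem depthConstants_rescaledCompletion_le_of_lt_pow (hp : 2 < p) {B : ℕ}
    (hlt : absRamificationIdx p (RescaledCompletion K p w hw) < p ^ B * (p - 1)) :
    differentOrd p (RescaledCompletion K p w hw)
      + logRadiusA p (absRamificationIdx p (RescaledCompletion K p w hw))
      + logRadiusB p (absRamificationIdx p (RescaledCompletion K p w hw)) ≤
      (B : ℝ) + 1 + 1 / ((p : ℝ) - 2) - 1 / (absRamificationIdx p (RescaledCompletion K p w hw) : ℝ)
        + padicValNat p (absRamificationIdx p (RescaledCompletion K p w hw)) := by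
  have hp0 : 0 < p := by omega
  have hhi : p * absRamificationIdx p (RescaledCompletion K p w hw) < p ^ (B + 1) * (p - 1) := by
    have := Nat.mul_lt_mul_of_pos_left hlt hp0
    calc p * absRamificationIdx p (RescaledCompletion K p w hw) < p * (p ^ B * (p - 1)) := this
      _ = p ^ (B + 1) * (p - 1) := by ring
  have h1 := depthConstants_rescaledCompletion_le_of_lt_window K p w hw hp hhi
  have he := absRamificationIdx_pos p (RescaledCompletion K p w hw)
  have he' : (0 : ℝ) < (absRamificationIdx p (RescaledCompletion K p w hw) : ℝ) := by exact_mod_cast he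
  have he1 : (1 : ℝ) ≤ (absRamificationIdx p (RescaledCompletion K p w hw) : ℝ) := by exact_mod_cast he
  have hp2 : (0 : ℝ) < (p : ℝ) - 2 := by
    have : (2 : ℝ) < p := by exact_mod_cast hp
    linarith
  -- `−(p−1)/((p−2)e) ≤ −1/e` since `(p−1)/(p−2) ≥ 1`
  have hcmp : 1 / (absRamificationIdx p (RescaledCompletion K p w hw) : ℝ) ≤
      ((p : ℝ) - 1) / (((p : ℝ) - 2) * absRamificationIdx p (RescaledCompletion K p w hw)) := by
    rw [div_le_div_iff₀ he' (mul_pos hp2 he')]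
    nlinarith
  have hB : ((B + 1 : ℕ) : ℝ) = (B : ℝ) + 1 := by push_cast; ring
  linarith

end Literature.IUT.LogVolume

end
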